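import Literature.AnabelianGeometry.SemiGraphs.TemperedCompletionExistence
import Literature.AnabelianGeometry.SemiGraphs.ProfiniteCompletionCoordinates
import HarnessLib

/-!
# The frozen predicate `IsProfiniteCompletion`: Mathlib's profinite completion of a discrete group
# is a model; the comparison isomorphism is unique; the kernel of a completion map

Mochizuki, *Semi-graphs of anabelioids*, Publ. RIMS **42** (2006), §6 p. 69: "we shall denote the
profinite completion of a group by means of a `∧`" [cite: MochizukiSemiAnbd2006, §6 p.69].  PROOF-ONLY
file (abc-iut L3, B7f; no definitions) complementing `TemperedCompletionExistence.lean` (existence /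
uniqueness-existence / injectivity criterion, abc-iut-L2-d1) and `TemperedCompletionExtension.lean`
(universal property, abc-iut-w5-d139) for the tree's frozen interface `IsProfiniteCompletion ι`
(`TemperedAnabelian.lean`):

* `IsProfiniteCompletion.continuousMulEquiv_unique` — the comparison isomorphism between two profinite
  completions (`nonempty_continuousMulEquiv`) is UNIQUE: "unique up to unique isomorphism";
* `IsProfiniteCompletion.map_eq_one_iff` — KERNEL: `ι x = 1` iff `x` lies in every open normal
  subgroup of finite index (refines `injective_iff`);
* `isProfiniteCompletion_toProfiniteCompletion` — MODEL: for a DISCRETE group `F`, Mathlib's canonical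
  `toProfiniteCompletion F : F → ProfiniteGrp.ProfiniteCompletion.completion F` — the map in which
  [SemiAnbd] Lem. 6.1 (i) / 6.3 (i) are typed (`FreeGroupNormallyTerminalInCompletion`, …) — satisfies
  `IsProfiniteCompletion`; hence (`exists_continuousMulEquiv_toProfiniteCompletion`) every abstract
  profinite completion of a discrete group is isomorphic to Mathlib's, compatibly with the two maps, so
  statements typed over Mathlib's completion transfer to every `IsProfiniteCompletion` datum.

Classical; nothing here takes a side on [IUTchIII] Cor. 3.12.
-/

noncomputable section

namespace Literature.AnabelianGeometry.SemiGraphs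

open CategoryTheory ProfiniteGrp ProfiniteGrp.ProfiniteCompletion
open _root_.Topology

universe u v w

namespace IsProfiniteCompletion

variable {F : Type u} {Fhat₁ : Type v} {Fhat₂ : Type w} [Group F] [TopologicalSpace F]
  [Group Fhat₁] [TopologicalSpace Fhat₁] [Group Fhat₂] [TopologicalSpace Fhat₂]
  {ι₁ : F →ₜ* Fhat₁} {ι₂ : F →ₜ* Fhat₂}

/-- **The comparison isomorphism is unique**: two isomorphisms of topological groups `F̂₁ ≃ₜ* F̂₂`
compatible with the completion maps `ι₁`, `ι₂` agree (density of `ι₁(F)`, `F̂₂` Hausdorff) — with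
`nonempty_continuousMulEquiv`, the profinite completion is unique up to UNIQUE isomorphism
([SemiAnbd] §6 p. 69 "the profinite completion"). [cite: MochizukiSemiAnbd2006, §6 p.69] -/
theorem continuousMulEquiv_unique (h₁ : IsProfiniteCompletion ι₁) (h₂ : IsProfiniteCompletion ι₂)
    (e e' : Fhat₁ ≃ₜ* Fhat₂) (he : ∀ x : F, e (ι₁ x) = ι₂ x) (he' : ∀ x : F, e' (ι₁ x) = ι₂ x) :
    e = e' := by
  haveI := h₂.t2Space
  have h : (e : Fhat₁ →ₜ* Fhat₂) = (e' : Fhat₁ →ₜ* Fhat₂) :=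
    h₁.extension_unique _ _ fun x => by
      change e (ι₁ x) = e' (ι₁ x)
      rw [he, he']
  ext y
  exact DFunLike.congr_fun h y

/-- **Kernel of a profinite-completion map**: for `ι : F → F̂` a profinite completion (`F̂` a
topological group), `ι x = 1` iff `x` lies in every open normal subgroup of finite index of `F`
(these are exactly the pull-backs of the open normal subgroups of `F̂`, which separate the points of
the profinite `F̂`). [cite: MochizukiSemiAnbd2006, Prop 3.6(iii) p.38] -/
theorem map_eq_one_iff [IsTopologicalGroup Fhat₁] (h₁ : IsProfiniteCompletion ι₁) (x : F) :
    ι₁ x = 1 ↔ ∀ U : OpenNormalSubgroup F, U.toSubgroup.FiniteIndex → x ∈ U.toSubgroup := by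
  haveI := h₁.compactSpace; haveI := h₁.t2Space; haveI := h₁.totallyDisconnectedSpace
  constructor
  · intro hx U hU
    obtain ⟨V, hV⟩ := h₁.comap_surjective U hU
    rw [hV, Subgroup.mem_comap]
    change ι₁ x ∈ V.toSubgroup
    rw [hx]
    exact V.toSubgroup.one_mem
  · intro hx
    by_contra hne
    obtain ⟨V, hV⟩ := ProfiniteGrp.exist_openNormalSubgroup_sub_open_nhds_of_one
      (isOpen_compl_singleton (x := ι₁ x)) (by simpa using fun h => hne h.symm)
    haveI : V.toSubgroup.Normal := V.isNormal'
    have hfi : (V.toSubgroup.comap ι₁.toMonoidHom).FiniteIndex := by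
      haveI : V.toSubgroup.FiniteIndex := Subgroup.finiteIndex_of_finite_quotient
      haveI : V.toSubgroup.IsFiniteRelIndex ι₁.toMonoidHom.range :=
        Subgroup.isFiniteRelIndex_of_finiteIndex
      exact ⟨by rw [Subgroup.index_comap]; exact Subgroup.relIndex_ne_zero⟩
    have hmem := hx { toSubgroup := V.toSubgroup.comap ι₁.toMonoidHom,
                      isOpen' := h₁.isOpen_comap V } hfi
    exact hV hmem rfl

end IsProfiniteCompletion

/-! ### Mathlib's profinite completion of a discrete group is a model -/

section Model

variable (F : Type u) [Group F] [TopologicalSpace F] [DiscreteTopology F]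

omit [TopologicalSpace F] [DiscreteTopology F] in
/-- The `K`-th coordinate projection `F̂ → F ⧸ K` of Mathlib's profinite completion has OPEN kernel
(it is continuous to a discrete group). [cite: MochizukiSemiAnbd2006, §6 p.69] -/
theorem isOpen_setOf_completion_val_eq_one (K : FiniteIndexNormalSubgroup F) :
    IsOpen {x : completion (GrpCat.of F) | x.val K = 1} := by
  haveI : DiscreteTopology ((diagram (GrpCat.of F)).obj K) := completion_discreteTopology_obj K
  exact (isOpen_discrete ({1} : Set ((diagram (GrpCat.of F)).obj K))).preimage
    (completion_continuous_val K)

/-- **Mathlib's profinite completion is a profinite completion in the sense of the frozen interface**: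
for a DISCRETE group `F`, the canonical map `ι : F → F̂ = lim F/K` (`toProfiniteCompletion F`, in
which [SemiAnbd] Lem. 6.1 (i) / 6.3 (i) are typed) satisfies `IsProfiniteCompletion` — `F̂` is
profinite (Mathlib instances), `ι` has dense range (`ProfiniteCompletion.denseRange`), every normal
subgroup `U` of finite index is the pull-back of the open normal kernel of the coordinate projection
`F̂ → F ⧸ U`, and every pull-back is open (`F` discrete). [cite: MochizukiSemiAnbd2006, §6 p.69] -/
theorem isProfiniteCompletion_toProfiniteCompletion :
    IsProfiniteCompletion
      ({ toMonoidHom := toProfiniteCompletion F,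
         continuous_toFun := continuous_of_discreteTopology } :
        F →ₜ* completion (GrpCat.of F)) where
  compactSpace := inferInstance
  t2Space := inferInstance
  totallyDisconnectedSpace := inferInstance
  denseRange := ProfiniteGrp.ProfiniteCompletion.denseRange (GrpCat.of F)
  comap_surjective U hU := by
    haveI : U.toSubgroup.Normal := U.isNormal'
    haveI : U.toSubgroup.FiniteIndex := hU
    let K : FiniteIndexNormalSubgroup F := { toSubgroup := U.toSubgroup }
    -- the kernel of the `K`-th coordinate projection, as an open normal subgroup of `F̂`
    let V : OpenNormalSubgroup (completion (GrpCat.of F)) :=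
      { toSubgroup :=
          { carrier := {x | x.val K = 1}
            mul_mem' := fun {x y} hx hy => by
              change (x * y).val K = 1
              rw [completion_mul_val, hx, hy, mul_one]
            one_mem' := completion_one_val K
            inv_mem' := fun {x} hx => by
              change x⁻¹.val K = 1
              rw [completion_inv_val, hx, inv_one] }
        isOpen' := isOpen_setOf_completion_val_eq_one F K
        isNormal' := ⟨fun x hx g => by
          change (g * x * g⁻¹).val K = 1
          rw [completion_mul_val, completion_mul_val, completion_inv_val, hx, mul_one,
            mul_inv_cancel]⟩ }
    refine ⟨V, ?_⟩
    ext f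
    rw [Subgroup.mem_comap]
    change f ∈ U.toSubgroup ↔ ((f : F ⧸ K.toSubgroup) : F ⧸ K.toSubgroup) = (1 : F ⧸ K.toSubgroup)
    rw [QuotientGroup.eq_one_iff]
  isOpen_comap V := isOpen_discrete _

/-- **Any profinite completion of a discrete group is Mathlib's, canonically**: if `ι : F → F̂`
satisfies `IsProfiniteCompletion` (`F` discrete, `F̂` a topological group), there is an isomorphism of
topological groups `e : completion F ≃ₜ* F̂` with `e (toProfiniteCompletion F x) = ι x` (unique by
`continuousMulEquiv_unique`) — so statements typed over Mathlib's completion ([SemiAnbd] Lem. 6.1 (i),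
6.3 (i)) transfer to every abstract completion. [cite: MochizukiSemiAnbd2006, §6 p.69] -/
theorem exists_continuousMulEquiv_toProfiniteCompletion {Fhat : Type v} [Group Fhat]
    [TopologicalSpace Fhat] [IsTopologicalGroup Fhat] {ι : F →ₜ* Fhat} (hι : IsProfiniteCompletion ι) :
    ∃ e : completion (GrpCat.of F) ≃ₜ* Fhat, ∀ x : F, e (toProfiniteCompletion F x) = ι x :=
  (isProfiniteCompletion_toProfiniteCompletion F).nonempty_continuousMulEquiv hι

end Model

end Literature.AnabelianGeometry.SemiGraphs

end
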